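import Literature.AlgebraicGeometry.Resolution.AlterationsLemma411VertexClosed
import Literature.AlgebraicGeometry.Resolution.AlterationsMultisectionEtaleNhdLemmas
import Literature.AlgebraicGeometry.Resolution.AlterationsBoundarySmoothLocus
import Literature.AlgebraicGeometry.Resolution.EtaleOverNhd
import Literature.AlgebraicGeometry.Resolution.EtaleNhdOfFlatUnramifiedPoint
import Literature.AlgebraicGeometry.Resolution.ResidueFieldsIntegralMorphisms
import Literature.AlgebraicGeometry.Resolution.ProjectiveSpaceRegular
import Literature.AlgebraicGeometry.Motives.ProjectiveSpaceFunctionField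
import Literature.AlgebraicGeometry.Motives.ProjectiveNoetherNormalization
import Literature.AlgebraicGeometry.Motives.FiberStalk
import Literature.RingTheory.Flat.RegularFibreFlat
import HarnessLib

/-!
# De Jong 1996, Lemma 4.11: `π` is étale over the vertex as soon as its fibre there is reduced

Topic: `Literature/AlgebraicGeometry/Resolution`. A PROVED layer for the open leaf
`DeJong1996Lemma411VertexChoice` (`AlterationsLemma411Vertex.lean`). That leaf asks for a finite
surjective `π : X → ℙ^{d+1}` which is ÉTALE OVER A NEIGHBOURHOOD of the (normalised) point
`p = vertex` — in print "Let `B ⊂ ℙ^d` be the branch locus of `π`, more precisely, the complement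
of `B` is the locus over which `π` is étale. […] for a general point `p ∈ ℙ^d`, `p ∉ B ∪ π(Z)`"
(de Jong 1996, proof of Lemma 4.11, p. 68). This file reduces that clause to a condition on the
single scheme-theoretic fibre `π⁻¹(p)`:

* `exists_etale_morphismRestrict_of_isReduced_fiber` — **let `π : X → Y` be a finite morphism
  of schemes locally of finite type over an algebraically closed field `k`, with `X` integral,
  and `p ∈ Y` a closed point at which `Y` is regular with `dim 𝒪_{Y,p} ≤ dim X`. If the
  scheme-theoretic fibre `π⁻¹(p)` is REDUCED then `π` is étale over an open neighbourhood of
  `p`.** For `x ∈ π⁻¹(p)`: the fibre is finite discrete and reduced, so `𝒪_{X,x}/𝔪_p𝒪_{X,x}`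
  is a field, i.e. `𝔪_p𝒪_{X,x} = 𝔪_x` and `κ(x) = κ(p)` (both are `k`); then `𝒪_{X,x}` is flat
  over the regular `𝒪_{Y,p}` by Matsumura's Thm. 23.1 for the (regular, zero-dimensional) fibre
  ring, the dimension inequality `dim 𝒪_{Y,p} + 0 ≤ dim 𝒪_{X,x} = dim X` holding at the closed
  point `x` of the variety `X` (`Literature.RingTheory.Flat.flat_of_isRegularLocalRing_of_isRegularLocalRing_fiber`,
  `ringKrullDim_stalk_eq_of_isClosed`); flat and unramified at `x` gives étale near `x`
  (EGA IV₄ 17.6.1, `exists_etale_ι_comp_of_flat_of_formallyUnramified_stalkMap`), and `π` being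
  closed, étale over a neighbourhood of `p` (`exists_etale_morphismRestrict_of_forall_exists_opens`).
* `exists_etale_morphismRestrict_vertex_of_isReduced_fiber` — the case of the leaf:
  `Y = ℙ^{d+1}_k` (regular, of dimension `d + 1` at the closed point `vertex`), `dim X = d + 1`.

So the étaleness clause of `DeJong1996.Lemma411Projection` holds for ANY finite `π` whose fibre
over the vertex is reduced — for `π = (t₀ : … : t_{d+1})` given by forms, the condition that
`X ∩ V₊(t₀, …, t_d)` be a reduced finite scheme, which is how the generic choice enters. No
named fact is introduced; [folklore] assembly of cited results, PROVED.

## Sources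

* A. J. de Jong, *Smoothness, semi-stability and alterations*, Publ. Math. IHÉS 83 (1996),
  proof of Lemma 4.11, p. 68. [DeJong1996]
* H. Matsumura, *Commutative Ring Theory* (1986), Thm. 23.1. [Matsumura1987]
* A. Grothendieck, J. Dieudonné, *EGA IV₄*, Publ. Math. IHÉS 32 (1967), Thm. 17.6.1.
  [Grothendieck1967]
-/

noncomputable section

open CategoryTheory CategoryTheory.Limits AlgebraicGeometry TopologicalSpace Topology IsLocalRing

attribute [local instance] MvPolynomial.gradedAlgebra

namespace Literature.AlgebraicGeometry.Resolution

universe u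

open Literature.AlgebraicGeometry.Motives (projectiveSpace)
open Literature.AlgebraicGeometry.Motives.Segre (grading toSpec)

/-! ## Étale over a closed regular point with reduced fibre -/

/-- **A finite morphism with reduced fibre over a closed regular point of the right dimension is
étale over a neighbourhood of that point.** Let `k` be algebraically closed, `X` integral and
`Y` schemes locally of finite type over `k`, `π : X → Y` a finite `k`-morphism, `p ∈ Y` a closed
point with `𝒪_{Y,p}` regular and `dim 𝒪_{Y,p} ≤ dim X`, and suppose the scheme-theoretic fibre
`π⁻¹(p)` is reduced. Then `π` is étale over an open `V ∋ p`. (Matsumura 23.1 for the fibre ring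
`𝒪_{X,x}/𝔪_p𝒪_{X,x} = κ(x)`, EGA IV₄ 17.6.1, and closedness of `π`.)
[cite: Matsumura1987, Thm. 23.1] [cite: Grothendieck1967, Thm. 17.6.1] -/
theorem exists_etale_morphismRestrict_of_isReduced_fiber {k : Type u} [Field k] [IsAlgClosed k]
    {X Y : Scheme.{u}} [IsIntegral X] (π : X ⟶ Y) [IsFinite π] (gY : Y ⟶ Spec (.of k))
    [LocallyOfFiniteType gY] [LocallyOfFiniteType (π ≫ gY)] {p : Y}
    (hp : IsClosed ({p} : Set Y)) (hreg : IsRegularLocalRing (Y.presheaf.stalk p))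
    (hdim : ringKrullDim (Y.presheaf.stalk p) ≤ topologicalKrullDim X)
    [IsReduced (π.fiber p)] :
    ∃ V : Y.Opens, p ∈ V ∧ Etale (π ∣_ V) := by
  haveI : IsLocallyNoetherian Y := LocallyOfFiniteType.isLocallyNoetherian gY
  haveI : IsLocallyNoetherian X := LocallyOfFiniteType.isLocallyNoetherian (π ≫ gY)
  refine exists_etale_morphismRestrict_of_forall_exists_opens π p fun x hx => ?_
  subst hx
  haveI := hreg
  -- `𝒪_{X,x}/𝔪_p 𝒪_{X,x} = 𝒪_{π⁻¹(p),x}` is a field: the fibre is reduced and discrete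
  have hF : IsField (X.presheaf.stalk x ⧸
      (maximalIdeal (Y.presheaf.stalk (π x))).map (π.stalkMap x).hom) := by
    obtain ⟨e⟩ := Literature.AlgebraicGeometry.Motives.nonempty_stalkFiber_ringEquiv_asFiber π x
    exact MulEquiv.isField (isField_stalk_of_discreteTopology (π.asFiber x)) e.symm.toMulEquiv
  -- `x` is a closed point, so `dim 𝒪_{X,x} = dim X`
  have hxc : IsClosed ({x} : Set X) := isClosed_singleton_of_apply_eq π hp rfl
  have hdimB : ringKrullDim (X.presheaf.stalk x) = topologicalKrullDim X :=
    ringKrullDim_stalk_eq_of_isClosed (π ≫ gY) hxc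
  -- flat at `x`: Matsumura 23.1 with the regular zero-dimensional fibre ring
  have hfl : (π.stalkMap x).hom.Flat := by
    letI := (π.stalkMap x).hom.toAlgebra
    haveI : IsLocalHom (algebraMap (Y.presheaf.stalk (π x)) (X.presheaf.stalk x)) :=
      inferInstanceAs (IsLocalHom (π.stalkMap x).hom)
    have hF' : IsRegularLocalRing (X.presheaf.stalk x ⧸ (maximalIdeal (Y.presheaf.stalk (π x))).map
        (algebraMap (Y.presheaf.stalk (π x)) (X.presheaf.stalk x))) := by
      letI := hF.toField
      infer_instance
    have h0 : ringKrullDim (X.presheaf.stalk x ⧸ (maximalIdeal (Y.presheaf.stalk (π x))).map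
        (algebraMap (Y.presheaf.stalk (π x)) (X.presheaf.stalk x))) = 0 :=
      ringKrullDim_eq_zero_of_isField hF
    have hle : ringKrullDim (Y.presheaf.stalk (π x)) + ringKrullDim (X.presheaf.stalk x ⧸
        (maximalIdeal (Y.presheaf.stalk (π x))).map
          (algebraMap (Y.presheaf.stalk (π x)) (X.presheaf.stalk x))) ≤
        ringKrullDim (X.presheaf.stalk x) := by
      rw [h0, add_zero, hdimB]
      exact hdim
    exact Literature.RingTheory.Flat.flat_of_isRegularLocalRing_of_isRegularLocalRing_fiber hF' hle
  -- unramified at `x`: `𝔪_p 𝒪_x = 𝔪_x` and `κ(x) = κ(p) = k`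
  haveI : IsAlgClosed (Y.residueField (π x)) := isAlgClosed_residueField_of_isClosed gY hp
  have hur : (π.stalkMap x).hom.FormallyUnramified := by
    refine formallyUnramified_stalkMap_of_isField π x hF ?_
    letI : Algebra (Y.residueField (π x)) (X.residueField x) := (π.residueFieldMap x).hom.toAlgebra
    haveI : Module.Finite (Y.residueField (π x)) (X.residueField x) :=
      Scheme.Hom.finite_residueField_of_isFinite π x
    exact Algebra.IsAlgebraic.isSeparable_of_perfectField
  exact exists_etale_ι_comp_of_flat_of_formallyUnramified_stalkMap π x hfl hur

/-! ## Over the vertex of `ℙ^{d+1}` -/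

namespace DeJong1996

variable (d : ℕ) (k : Type u) [Field k]

/-- `dim 𝒪_{ℙ^{d+1}, vertex} = d + 1` (the local ring at a closed point of the variety
`ℙ^{d+1}_k`). [folklore] -/
theorem ringKrullDim_stalk_vertex :
    ringKrullDim ((Proj (grading (Fin (d + 1 + 1)) k)).presheaf.stalk (vertex d k)) = (d + 1 : ℕ) := by
  haveI : IsProper (toSpec (Fin (d + 1 + 1)) k) :=
    Literature.AlgebraicGeometry.Motives.ProjSpace.isProper_over (d + 1) k
  rw [ringKrullDim_stalk_eq_of_isClosed (toSpec (Fin (d + 1 + 1)) k) (isClosed_singleton_vertex d k),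
    Literature.AlgebraicGeometry.Motives.ProjSpace.topologicalKrullDim_eq]

/-- `𝒪_{ℙ^{d+1}, vertex}` is a regular local ring (`ℙ^{d+1}_k` is regular). [folklore] -/
theorem isRegularLocalRing_stalk_vertex :
    IsRegularLocalRing ((Proj (grading (Fin (d + 1 + 1)) k)).presheaf.stalk (vertex d k)) :=
  isRegular_projectiveSpace (n := d + 1) (k := k) (vertex d k)

/-- **`π : X → ℙ^{d+1}` is étale over a neighbourhood of the vertex as soon as the fibre
`π⁻¹(vertex)` is reduced** — for `k` algebraically closed, `X` integral of dimension `d + 1`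
and `π` a finite `k`-morphism: the étaleness clause of `DeJong1996.Lemma411Projection` at
`p = vertex` ("`p ∉ B`", de Jong 1996, proof of Lemma 4.11), from the single fibre.
[cite: DeJong1996, Lemma 4.11 (proof), p. 68] -/
theorem exists_etale_morphismRestrict_vertex_of_isReduced_fiber [IsAlgClosed k] {X : Scheme.{u}}
    [IsIntegral X] (π : X ⟶ Proj (grading (Fin (d + 1 + 1)) k)) [IsFinite π]
    [LocallyOfFiniteType (π ≫ toSpec (Fin (d + 1 + 1)) k)]
    (hdim : topologicalKrullDim X = (d + 1 : ℕ)) [IsReduced (π.fiber (vertex d k))] :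
    ∃ V : (Proj (grading (Fin (d + 1 + 1)) k)).Opens, vertex d k ∈ V ∧ Etale (π ∣_ V) := by
  haveI : IsProper (toSpec (Fin (d + 1 + 1)) k) :=
    Literature.AlgebraicGeometry.Motives.ProjSpace.isProper_over (d + 1) k
  refine exists_etale_morphismRestrict_of_isReduced_fiber π (toSpec (Fin (d + 1 + 1)) k)
    (isClosed_singleton_vertex d k) (isRegularLocalRing_stalk_vertex d k) ?_
  rw [ringKrullDim_stalk_vertex, hdim]
end DeJong1996

end Literature.AlgebraicGeometry.Resolution

end
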